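import Mathlib
import Summits.Ventures.PercRepro2.Defs
import Summits.Ventures.PercRepro2.Independence

/-!
# Finite bond percolation — graphs, connectivity, clusters (blind cell PercRepro2, typer-1)

A finite (multi)graph is an edge type `E` with an incidence map `ends : E → Sym2 V`.
For a configuration `ω : Config E`:

* `openGraph ends ω : SimpleGraph V` — the open subgraph (`SimpleGraph.fromRel` of the open
  adjacency `OpenAdj ends ω`); Mathlib's graph API applies to it;
* `Conn ends ω u v` — `u ↔ v` (`Reachable` in the open subgraph), `connEvent ends u v` the event;
* `cluster ends ω v` — the open cluster `C(v)`, `clusterEvent ends v S = {C(v) = S}`;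
* `touches / within / boundary ends S` — the edges meeting `S`, inside `S`, leaving `S`.

Main results: the **closure lemma** `mem_of_conn_of_closed`, the **domain Markov property**
`dependsOn_clusterEvent` (`{C(v) = S}` is determined by the edges touching `S`) and its
consequence `prob_clusterEvent_inter_eq_mul` (anything determined by the edges not touching
`S` is independent of `{C(v) = S}`).
-/

namespace Summit.Ventures.PercRepro2

section Graph

variable {V : Type*} {E : Type*}

/-- Open adjacency: some open edge of `ω` has endpoints `{u, v}`. -/
def OpenAdj (ends : E → Sym2 V) (ω : Config E) (u v : V) : Prop :=
  ∃ e, ω e = true ∧ ends e = s(u, v)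

/-- Open adjacency is symmetric. -/
lemma OpenAdj.symm {ends : E → Sym2 V} {ω : Config E} {u v : V} (h : OpenAdj ends ω u v) :
    OpenAdj ends ω v u := by
  obtain ⟨e, he, h⟩ := h
  exact ⟨e, he, by rw [h, Sym2.eq_swap]⟩

/-- The open subgraph of the configuration `ω`. -/
def openGraph (ends : E → Sym2 V) (ω : Config E) : SimpleGraph V :=
  SimpleGraph.fromRel (OpenAdj ends ω)

/-- Adjacency in the open subgraph. -/
lemma openGraph_adj {ends : E → Sym2 V} {ω : Config E} {u v : V} :
    (openGraph ends ω).Adj u v ↔ u ≠ v ∧ OpenAdj ends ω u v := by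
  simp only [openGraph, SimpleGraph.fromRel_adj]
  constructor
  · rintro ⟨h, h' | h'⟩
    · exact ⟨h, h'⟩
    · exact ⟨h, h'.symm⟩
  · rintro ⟨h, h'⟩
    exact ⟨h, Or.inl h'⟩

/-- The open subgraph is monotone in the configuration. -/
lemma openGraph_mono {ends : E → Sym2 V} {ω ω' : Config E} (h : ω ≤ ω') :
    openGraph ends ω ≤ openGraph ends ω' := by
  intro u v huv
  rw [openGraph_adj] at huv ⊢
  obtain ⟨hne, e, he, hends⟩ := huv
  refine ⟨hne, e, ?_, hends⟩
  have := h e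
  rw [he] at this
  exact Bool.le_iff_imp.1 this rfl

/-- Connection `u ↔ v`: `u` and `v` are joined by a path of open edges. -/
def Conn (ends : E → Sym2 V) (ω : Config E) (u v : V) : Prop := (openGraph ends ω).Reachable u v

/-- `u ↔ u`. -/
lemma conn_refl (ends : E → Sym2 V) (ω : Config E) (u : V) : Conn ends ω u u :=
  SimpleGraph.Reachable.refl u

/-- `u ↔ v` implies `v ↔ u`. -/
lemma conn_symm {ends : E → Sym2 V} {ω : Config E} {u v : V} (h : Conn ends ω u v) :
    Conn ends ω v u :=
  SimpleGraph.Reachable.symm h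

/-- `u ↔ v` and `v ↔ w` give `u ↔ w`. -/
lemma conn_trans {ends : E → Sym2 V} {ω : Config E} {u v w : V} (h₁ : Conn ends ω u v)
    (h₂ : Conn ends ω v w) : Conn ends ω u w :=
  SimpleGraph.Reachable.trans h₁ h₂

/-- An open edge connects its endpoints. -/
lemma conn_of_openAdj {ends : E → Sym2 V} {ω : Config E} {u v : V} (h : OpenAdj ends ω u v) :
    Conn ends ω u v := by
  by_cases huv : u = v
  · subst huv; exact conn_refl ends ω u
  · exact SimpleGraph.Adj.reachable (openGraph_adj.2 ⟨huv, h⟩)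

/-- Connection is monotone in the configuration. -/
lemma conn_mono {ends : E → Sym2 V} {ω ω' : Config E} (h : ω ≤ ω') {u v : V}
    (hc : Conn ends ω u v) : Conn ends ω' u v :=
  SimpleGraph.Reachable.mono (openGraph_mono h) hc

/-- **Closure lemma**: a vertex set closed under open adjacency and containing `v` contains
everything connected to `v`. -/
lemma mem_of_conn_of_closed {ends : E → Sym2 V} {ω : Config E} {S : Set V}
    (hS : ∀ x ∈ S, ∀ y, (openGraph ends ω).Adj x y → y ∈ S) {v u : V} (hv : v ∈ S)
    (h : Conn ends ω v u) : u ∈ S := by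
  rw [Conn, SimpleGraph.reachable_iff_reflTransGen] at h
  induction h with
  | refl => exact hv
  | tail _ hxy ih => exact hS _ ih _ hxy

/-- The connection event `{u ↔ v}`. -/
def connEvent (ends : E → Sym2 V) (u v : V) : Set (Config E) := {ω | Conn ends ω u v}

/-- Membership in `connEvent`. -/
@[simp] lemma mem_connEvent {ends : E → Sym2 V} {u v : V} {ω : Config E} :
    ω ∈ connEvent ends u v ↔ Conn ends ω u v := Iff.rfl

/-- Connection events are increasing. -/
lemma isUpperSet_connEvent (ends : E → Sym2 V) (u v : V) : IsUpperSet (connEvent ends u v) :=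
  fun _ _ h hω => conn_mono h hω

/-- The crossing event: some vertex of `A` is connected to some vertex of `B`. -/
def crossEvent (ends : E → Sym2 V) (A B : Set V) : Set (Config E) :=
  {ω | ∃ a ∈ A, ∃ b ∈ B, Conn ends ω a b}

/-- Crossing events are increasing. -/
lemma isUpperSet_crossEvent (ends : E → Sym2 V) (A B : Set V) :
    IsUpperSet (crossEvent ends A B) := by
  rintro ω ω' h ⟨a, ha, b, hb, hc⟩
  exact ⟨a, ha, b, hb, conn_mono h hc⟩

/-- The open cluster `C(v)` of the vertex `v`. -/
def cluster (ends : E → Sym2 V) (ω : Config E) (v : V) : Set V := {u | Conn ends ω v u}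

/-- Membership in the cluster. -/
@[simp] lemma mem_cluster {ends : E → Sym2 V} {ω : Config E} {v u : V} :
    u ∈ cluster ends ω v ↔ Conn ends ω v u := Iff.rfl

/-- `v ∈ C(v)`. -/
lemma mem_cluster_self (ends : E → Sym2 V) (ω : Config E) (v : V) : v ∈ cluster ends ω v :=
  conn_refl ends ω v

/-- Clusters are closed under open adjacency. -/
lemma mem_cluster_of_adj {ends : E → Sym2 V} {ω : Config E} {v x y : V}
    (hx : x ∈ cluster ends ω v) (hxy : (openGraph ends ω).Adj x y) : y ∈ cluster ends ω v :=
  conn_trans hx (SimpleGraph.Adj.reachable hxy)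

/-- The cluster is monotone in the configuration. -/
lemma cluster_mono {ends : E → Sym2 V} {ω ω' : Config E} (h : ω ≤ ω') (v : V) :
    cluster ends ω v ⊆ cluster ends ω' v :=
  fun _ hu => conn_mono h hu

/-- The event `{C(v) = S}`. -/
def clusterEvent (ends : E → Sym2 V) (v : V) (S : Set V) : Set (Config E) :=
  {ω | cluster ends ω v = S}

/-- Membership in `clusterEvent`. -/
@[simp] lemma mem_clusterEvent {ends : E → Sym2 V} {v : V} {S : Set V} {ω : Config E} :
    ω ∈ clusterEvent ends v S ↔ cluster ends ω v = S := Iff.rfl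

/-- The number of vertices of the cluster `C(v)`. -/
noncomputable def clusterCard (ends : E → Sym2 V) (ω : Config E) (v : V) : ℕ :=
  (cluster ends ω v).ncard

end Graph

/-! ## Edges touching, inside, and leaving a vertex set -/

section EdgeSets

variable {V : Type*} {E : Type*}

/-- Edges with at least one endpoint in `S`. -/
def touches (ends : E → Sym2 V) (S : Set V) : Set E := {e | ∃ x ∈ S, ∃ y, ends e = s(x, y)}

/-- Edges with both endpoints in `S`. -/
def within (ends : E → Sym2 V) (S : Set V) : Set E := {e | ∃ x ∈ S, ∃ y ∈ S, ends e = s(x, y)}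

/-- Edges with one endpoint in `S` and the other outside: the edge boundary `∂S`. -/
def boundary (ends : E → Sym2 V) (S : Set V) : Set E :=
  {e | ∃ x ∈ S, ∃ y ∉ S, ends e = s(x, y)}

/-- Membership in `touches`. -/
lemma mem_touches {ends : E → Sym2 V} {S : Set V} {e : E} :
    e ∈ touches ends S ↔ ∃ x ∈ S, ∃ y, ends e = s(x, y) := Iff.rfl

/-- Membership in `within`. -/
lemma mem_within {ends : E → Sym2 V} {S : Set V} {e : E} :
    e ∈ within ends S ↔ ∃ x ∈ S, ∃ y ∈ S, ends e = s(x, y) := Iff.rfl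

/-- Membership in `boundary`. -/
lemma mem_boundary {ends : E → Sym2 V} {S : Set V} {e : E} :
    e ∈ boundary ends S ↔ ∃ x ∈ S, ∃ y ∉ S, ends e = s(x, y) := Iff.rfl

/-- An edge with an endpoint in `S` touches `S` (either endpoint). -/
lemma mem_touches_of_ends {ends : E → Sym2 V} {S : Set V} {e : E} {x y : V}
    (h : ends e = s(x, y)) (hxy : x ∈ S ∨ y ∈ S) : e ∈ touches ends S := by
  rcases hxy with hx | hy
  · exact ⟨x, hx, y, h⟩
  · exact ⟨y, hy, x, by rw [h, Sym2.eq_swap]⟩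

/-- Inside edges touch `S`. -/
lemma within_subset_touches (ends : E → Sym2 V) (S : Set V) : within ends S ⊆ touches ends S :=
  fun _ ⟨x, hx, y, _, h⟩ => ⟨x, hx, y, h⟩

/-- Boundary edges touch `S`. -/
lemma boundary_subset_touches (ends : E → Sym2 V) (S : Set V) :
    boundary ends S ⊆ touches ends S :=
  fun _ ⟨x, hx, y, _, h⟩ => ⟨x, hx, y, h⟩

/-- The touching edges are the inside edges together with the boundary edges. -/
lemma touches_eq_within_union_boundary (ends : E → Sym2 V) (S : Set V) :
    touches ends S = within ends S ∪ boundary ends S := by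
  ext e
  constructor
  · rintro ⟨x, hx, y, h⟩
    by_cases hy : y ∈ S
    · exact Or.inl ⟨x, hx, y, hy, h⟩
    · exact Or.inr ⟨x, hx, y, hy, h⟩
  · rintro (h | h)
    · exact within_subset_touches ends S h
    · exact boundary_subset_touches ends S h

/-- Inside edges and boundary edges are disjoint. -/
lemma disjoint_within_boundary (ends : E → Sym2 V) (S : Set V) :
    Disjoint (within ends S) (boundary ends S) := by
  rw [Set.disjoint_left]
  rintro e ⟨x, hx, y, hy, h⟩ ⟨x', _, y', hy', h'⟩
  rw [h, Sym2.eq_iff] at h'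
  rcases h' with ⟨_, rfl⟩ | ⟨rfl, _⟩
  · exact hy' hy
  · exact hy' hx

/-- An edge touching `S` is an edge of the open cluster's "explored" region: the endpoints of an
edge not touching `S` both lie outside `S`. -/
lemma not_mem_of_not_mem_touches {ends : E → Sym2 V} {S : Set V} {e : E} {x y : V}
    (h : ends e = s(x, y)) (he : e ∉ touches ends S) : x ∉ S ∧ y ∉ S :=
  ⟨fun hx => he (mem_touches_of_ends h (Or.inl hx)),
    fun hy => he (mem_touches_of_ends h (Or.inr hy))⟩

end EdgeSets

/-! ## The domain Markov property -/

section Markov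

variable {V : Type*} {E : Type*}

/-- If `ω` and `ω'` agree on the edges touching `S` and `C_ω(v) = S`, then `C_{ω'}(v) = S`. -/
lemma cluster_eq_of_eqOn_touches {ends : E → Sym2 V} {ω ω' : Config E} {v : V} {S : Set V}
    (h : ∀ e ∈ touches ends S, ω e = ω' e) (hS : cluster ends ω v = S) :
    cluster ends ω' v = S := by
  have hvS : v ∈ S := hS ▸ mem_cluster_self ends ω v
  apply Set.Subset.antisymm
  · intro u hu
    refine mem_of_conn_of_closed (ends := ends) (ω := ω') ?_ hvS hu
    intro x hx y hxy
    obtain ⟨_, e, he, hends⟩ := openGraph_adj.1 hxy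
    have he' : ω e = true := by rw [h e ⟨x, hx, y, hends⟩]; exact he
    rw [← hS] at hx ⊢
    exact conn_trans hx (conn_of_openAdj ⟨e, he', hends⟩)
  · intro u hu
    rw [← hS] at hu
    have key : u ∈ {x | x ∈ S ∧ Conn ends ω' v x} := by
      refine mem_of_conn_of_closed (ends := ends) (ω := ω) ?_ ⟨hvS, conn_refl ends ω' v⟩ hu
      rintro x ⟨hxS, hxc⟩ y hxy
      obtain ⟨_, e, he, hends⟩ := openGraph_adj.1 hxy
      have he' : ω' e = true := by rw [← h e ⟨x, hxS, y, hends⟩]; exact he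
      refine ⟨?_, conn_trans hxc (conn_of_openAdj ⟨e, he', hends⟩)⟩
      rw [← hS] at hxS ⊢
      exact conn_trans hxS (conn_of_openAdj ⟨e, he, hends⟩)
    exact key.2

/-- **Domain Markov property**: the event `{C(v) = S}` is determined by the edges touching `S`. -/
theorem dependsOn_clusterEvent (ends : E → Sym2 V) (v : V) (S : Set V) :
    DependsOn (· ∈ clusterEvent ends v S) (touches ends S) := by
  intro ω ω' h
  exact propext ⟨cluster_eq_of_eqOn_touches h,
    cluster_eq_of_eqOn_touches fun e he => (h e he).symm⟩

variable [Fintype E] [DecidableEq E] {R : Type*} [CommRing R]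

/-- **Domain Markov property, probabilistic form**: an event determined by edges not touching
`S` is independent of `{C(v) = S}`. -/
theorem prob_clusterEvent_inter_eq_mul (p : E → R) (ends : E → Sym2 V) (v : V) (S : Set V)
    {A : Set (Config E)} {F : Set E} (hA : DependsOn (· ∈ A) F)
    (hF : Disjoint (touches ends S) F) :
    prob p (clusterEvent ends v S ∩ A) = prob p (clusterEvent ends v S) * prob p A :=
  prob_inter_eq_mul_of_dependsOn p hF (dependsOn_clusterEvent ends v S) hA

end Markov

/-! ## Decidability on finite graphs -/

section Decidable

variable {V : Type*} {E : Type*} [Fintype E] [DecidableEq V]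

/-- Open adjacency is decidable on a finite edge set. -/
instance (ends : E → Sym2 V) (ω : Config E) : DecidableRel (OpenAdj ends ω) := fun u v =>
  inferInstanceAs (Decidable (∃ e, ω e = true ∧ ends e = s(u, v)))

/-- Adjacency in the open subgraph is decidable. -/
instance (ends : E → Sym2 V) (ω : Config E) : DecidableRel (openGraph ends ω).Adj :=
  inferInstanceAs (DecidableRel (SimpleGraph.fromRel (OpenAdj ends ω)).Adj)

/-- Connection is decidable on a finite graph. -/
instance [Fintype V] (ends : E → Sym2 V) (ω : Config E) : DecidableRel (Conn ends ω) := fun u v =>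
  inferInstanceAs (Decidable ((openGraph ends ω).Reachable u v))

end Decidable

end Summit.Ventures.PercRepro2
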